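import Mathlib
import Summits.NavierStokesRegularity.NavierStokesRegularity.Theorems.L3TimeExponentPincerSubparabolicMorreyRate
import HarnessLib.Audit
import HarnessLib

/-!
# The Morrey-side node of the parent crux after J‴: sub-parabolic scaled energies grow at most like
# `(T-t)^{-1/5}` (route `L3TimeExponentPincer`, parent crux `L3CascadeJaw` stmt-NavierStokesRegularity-19499;
# support file 14 of seat p4)

Support file (cell ns-regularity-ideate, seat p4, gen 5).  0 `sorry`; one `@[conjecture]` node (a typed hypothesis,
NOT asserted).

The Morrey programme of the route had one node BY NAME for the parent crux on its side:
`AllBlowupsFullMorreyB` (`…JawFullMorrey`, every frame blow-up is scaled-energy-Type-I at ALL radii `< r₁`),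
with `NoTypeII ⇒ AllBlowupsFullMorreyB ⇒ L3CascadeJaw`.  After THEOREM J‴ and its rate form
(`…SubparabolicMorreyRate.l3CascadeJaw_clause_of_subparabolicMorreyPowerRate`) the natural node is much weaker:

  `AllBlowupsSubparabolicFifthB`: every frame blow-up has `∫_{B(x₀,r)}|u(t)|² ≤ M (T-t)^{-1/5} r` for all late
  `t`, all `x₀` and all SUB-PARABOLIC radii `0 < r ≤ √(T-t)` —

nothing is asked at radii `> √(T-t)`, and at the bottom radii the scaled energies may GROW like `(T-t)^{-1/5}`
(the rate of the Euler-speed cascade at `r = √(T-t)`, i.e. the node sits exactly on the heuristic border of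
the crux, as a Morrey-side node should).

* `l3CascadeJaw_of_allBlowupsSubparabolicFifthB` — **the parent crux BY NAME** from the node (smooth branch =
  the landed `jawSmoothBranch_holds`; blow-up branch = `l3CascadeJaw_clause_of_subparabolicMorreyPowerRate`);
* `allBlowupsSubparabolicFifthB_of_allBlowupsFullMorreyB`, `allBlowupsSubparabolicFifthB_of_noTypeII` — the
  ladder `NoTypeII ⇒ AllBlowupsFullMorreyB ⇒ AllBlowupsSubparabolicFifthB ⇒ L3CascadeJaw`
  (the middle arrow: a constant bound is a `(T-t)^{-1/5}` bound on the window `T - t ≤ 1`);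
* `subparabolicFifth_of_typeI` — a single time-Type-I blow-up satisfies the node's clause (elementary).

WHAT THIS IS NOT: not a claim about Navier–Stokes regularity; the node is OPEN (it is implied by `NoTypeII`, hard
core 0056, through `AllBlowupsFullMorreyB`, and is not known otherwise); no item or stub is closed.
-/

noncomputable section

namespace Summit.NavierStokesRegularity.NavierStokesRegularity.Theorems.L3TimeExponentPincerSubparabolicFifthNode

open MeasureTheory Set Function Filter Metric Topology
open scoped ENNReal NNReal
open Literature.Analysis.FluidPDE
open Summit.NavierStokesRegularity.NavierStokesRegularity.Theorems.L3TimeExponentPincerJawFullMorrey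
  (FullMorreyTypeINear AllBlowupsFullMorreyB allBlowupsFullMorreyB_of_noTypeII)
open Summit.NavierStokesRegularity.NavierStokesRegularity.Theorems.L3TimeExponentPincerSubparabolicMorreyJaw
  (SubparabolicMorreyNear subparabolicMorreyNear_of_full subparabolicMorreyNear_of_typeI)
open Summit.NavierStokesRegularity.NavierStokesRegularity.Theorems.L3TimeExponentPincerSubparabolicMorreyRate
  (l3CascadeJaw_clause_of_subparabolicMorreyPowerRate)
open Summit.NavierStokesRegularity.NavierStokesRegularity.Theses.L3TimeExponentPincer (L3CascadeJaw)

/-- **Node (OPEN, typed hypothesis): every frame blow-up has sub-parabolic scaled energies `≲ (T-t)^{-1/5}`** —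
`∫_{B(x₀,r)} |u(t)|² ≤ M (T-t)^{-1/5} r` for all late `t`, all centres and all `0 < r ≤ √(T-t)`.  Implied by
`NoTypeII` (hard core 0056) through `AllBlowupsFullMorreyB`; the Euler-speed cascade heuristic sits exactly at
the exponent `1/5`. -/
@[conjecture] def AllBlowupsSubparabolicFifthB : Prop :=
  ∀ (ν T : ℝ), 0 < ν → 0 < T →
    ∀ (u : ℝ → (EuclideanSpace ℝ (Fin 3)) → (EuclideanSpace ℝ (Fin 3))) (p : ℝ → (EuclideanSpace ℝ (Fin 3)) → ℝ),
    IsClassicalNSSolutionOn (Ico 0 T) ν 0 u p → IsLerayHopfOn T ν 0 (u 0) u →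
    HasRapidSpatialDecay (u 0) → ¬ HasSmoothExtensionPast ν 0 u T →
    ∃ M : ℝ, 0 ≤ M ∧ ∃ T₁ < T, ∀ t ∈ Ioo T₁ T, ∀ x₀ : EuclideanSpace ℝ (Fin 3), ∀ r : ℝ, 0 < r → r ^ 2 ≤ T - t →
      ∫⁻ x in ball x₀ r, ‖u t x‖ₑ ^ 2 ≤ ENNReal.ofReal (M * (T - t) ^ (-(1 / 5 : ℝ)) * r)

/-- **The parent crux BY NAME from the sub-parabolic node**: `AllBlowupsSubparabolicFifthB ⇒ L3CascadeJaw`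
(`stmt-NavierStokesRegularity-19499`).  Smooth branch: `jawSmoothBranch_holds`; blow-up branch: the rate form of
THEOREM J‴ with `β = 1/5`. -/
theorem l3CascadeJaw_of_allBlowupsSubparabolicFifthB (hA : AllBlowupsSubparabolicFifthB) : L3CascadeJaw := by
  intro q hq4 hq5 ν T hν hT u p hcl hLH hdec
  by_cases hext : HasSmoothExtensionPast ν 0 u T
  · exact Summit.NavierStokesRegularity.NavierStokesRegularity.Theorems.L3TimeExponentPincerSmoothBranch.jawSmoothBranch_holds
      q hq4 hq5 ν T hν hT u p hcl hLH hdec hext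
  · obtain ⟨M, hM, hrate⟩ := hA ν T hν hT u p hcl hLH hdec hext
    obtain ⟨T₂, hT₂, h⟩ := l3CascadeJaw_clause_of_subparabolicMorreyPowerRate q hq4 hq5 hν hT hcl hLH hdec hM
      (by norm_num : (0 : ℝ) ≤ 1 / 5) le_rfl hrate
    exact ⟨T₂, hT₂, h⟩

/-- A sub-parabolic-Morrey (constant bound) field satisfies the node's `(T-t)^{-1/5}` clause on the window
`T - t ≤ 1` (`M ≤ M (T-t)^{-1/5}` there). -/
theorem subparabolicFifth_of_subparabolicMorreyNear
    {u : ℝ → (EuclideanSpace ℝ (Fin 3)) → (EuclideanSpace ℝ (Fin 3))} {T : ℝ} (hS : SubparabolicMorreyNear u T) :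
    ∃ M : ℝ, 0 ≤ M ∧ ∃ T₁ < T, ∀ t ∈ Ioo T₁ T, ∀ x₀ : EuclideanSpace ℝ (Fin 3), ∀ r : ℝ, 0 < r → r ^ 2 ≤ T - t →
      ∫⁻ x in ball x₀ r, ‖u t x‖ₑ ^ 2 ≤ ENNReal.ofReal (M * (T - t) ^ (-(1 / 5 : ℝ)) * r) := by
  obtain ⟨M, hM, T₁, hT₁, hMor⟩ := hS
  refine ⟨M, hM.le, max T₁ (T - 1), max_lt hT₁ (by linarith), fun t ht x₀ r hr hrs => ?_⟩
  have ht1 : T₁ < t := lt_of_le_of_lt (le_max_left _ _) ht.1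
  have ht2 : T - 1 < t := lt_of_le_of_lt (le_max_right _ _) ht.1
  have hs : 0 < T - t := sub_pos.2 ht.2
  have hs1 : T - t ≤ 1 := by linarith
  refine (hMor t ⟨ht1, ht.2⟩ x₀ r hr hrs).trans (ENNReal.ofReal_le_ofReal ?_)
  have hpow : 1 ≤ (T - t) ^ (-(1 / 5 : ℝ)) := by
    rw [Real.rpow_neg hs.le]
    exact one_le_inv_iff₀.2 ⟨Real.rpow_pos_of_pos hs _, Real.rpow_le_one hs.le hs1 (by norm_num)⟩
  nlinarith [mul_nonneg hM.le hr.le]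

/-- `AllBlowupsFullMorreyB ⇒ AllBlowupsSubparabolicFifthB` (full Morrey ⇒ sub-parabolic Morrey ⇒ the
`(T-t)^{-1/5}` clause). -/
theorem allBlowupsSubparabolicFifthB_of_allBlowupsFullMorreyB (hA : AllBlowupsFullMorreyB) :
    AllBlowupsSubparabolicFifthB :=
  fun ν T hν hT u p hcl hLH hdec hext =>
    subparabolicFifth_of_subparabolicMorreyNear (subparabolicMorreyNear_of_full (hA ν T hν hT u p hcl hLH hdec hext))

/-- A single time-Type-I blow-up satisfies the node's clause (elementary: `|u| ≤ C/√s` ⇒ sub-parabolic Morrey). -/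
theorem subparabolicFifth_of_typeI {u : ℝ → (EuclideanSpace ℝ (Fin 3)) → (EuclideanSpace ℝ (Fin 3))} {T : ℝ}
    (hTI : IsTypeIBlowup u T) :
    ∃ M : ℝ, 0 ≤ M ∧ ∃ T₁ < T, ∀ t ∈ Ioo T₁ T, ∀ x₀ : EuclideanSpace ℝ (Fin 3), ∀ r : ℝ, 0 < r → r ^ 2 ≤ T - t →
      ∫⁻ x in ball x₀ r, ‖u t x‖ₑ ^ 2 ≤ ENNReal.ofReal (M * (T - t) ^ (-(1 / 5 : ℝ)) * r) :=
  subparabolicFifth_of_subparabolicMorreyNear (subparabolicMorreyNear_of_typeI hTI)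

/-- **The ladder's top**: hard core `NoTypeII` (`stmt-NavierStokesRegularity-0056`) ⇒ the node
(through `AllBlowupsFullMorreyB`; the direct elementary route is `subparabolicFifth_of_typeI`). -/
theorem allBlowupsSubparabolicFifthB_of_noTypeII
    (h : Summit.NavierStokesRegularity.NavierStokesRegularity.Theses.TypeICertificateLadder.NoTypeII) :
    AllBlowupsSubparabolicFifthB :=
  allBlowupsSubparabolicFifthB_of_allBlowupsFullMorreyB (allBlowupsFullMorreyB_of_noTypeII h)

end Summit.NavierStokesRegularity.NavierStokesRegularity.Theorems.L3TimeExponentPincerSubparabolicFifthNode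

end
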